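import Literature.Algebra.Homology.QuasiIsoHomotopyEquivField
import Literature.Algebra.Homology.KunnethMapIsoUnbounded
import HarnessLib

/-!
# Over a field, the tensor product of complexes preserves quasi-isomorphisms (both factors, unbounded)

Layer `Literature/Algebra/Homology` (pure homological algebra over Mathlib; proved theorems only, 0 definitions, 0 named
facts, no instances, no notation). For cochain complexes of vector spaces over a field `k` (Mathlib's monoidal structure
`HomologicalComplex.tensorObj` ∕ `tensorHom` on `CochainComplex (ModuleCat k) ℤ`):

* **`quasiIso_tensorHom_of_field : QuasiIso φ → QuasiIso ψ → QuasiIso (HomologicalComplex.tensorHom φ ψ)`** for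
  ARBITRARY (unbounded) complexes and BOTH factors — every complex of vector spaces is K-flat: by row
  `QuasiIsoHomotopyEquivField` (`exists_homotopyEquiv_hom_eq_of_quasiIso`) `φ`, `ψ` are homotopy equivalences, and
  homotopy equivalences survive tensoring (row `KunnethMapIsoUnbounded`'s `tensorHomotopyEquiv`);
* `quasiIso_whiskerLeft_of_field` (`C ◁ ψ`), `quasiIso_whiskerRight_of_field` (`φ ▷ D`), and the induced homology
  isomorphism `isIso_homologyMap_tensorHom_of_field`.

What is new relative to the tree (cited, not restated): `Literature.Algebra.Homology.FlatQuasiIsoBaseChange.quasiIso_tensorLeft_map_of_flat`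
is ONE-sided (`M ⊗ –` for a module `M`), bounded-above and needs degreewise flatness; `KunnethField.quasiIso_map_tensorLeft ∕
_tensorRight` are one-sided with a MODULE `M`; `KunnethMapIso.quasiIso_tensorHom_of_bounded` is two-sided but BOUNDED;
`KunnethMapIsoUnbounded.quasiIso_tensorHom_homotopyEquivHomologyOfField` is the special pair `(ρ_C, ρ_D)`. Here: two-sided, both
maps arbitrary quasi-isomorphisms of complexes, no boundedness. Mathlib (pin v4.32) has no such statement.

Library only (cell `pub-hodge-ring2`, count-neutral); proves nothing about any crux, route or conjecture.

## References

* C. A. Weibel, *An introduction to homological algebra* (1994), Thm. 3.6.3, 2.7.1, §10.4 (K-flatness is automatic over a field). [Weibel1994]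
* H. Cartan, S. Eilenberg, *Homological Algebra* (1956), VI.3, Thm. 3.1. [CartanEilenberg1956]
-/

open CategoryTheory CategoryTheory.Limits CategoryTheory.MonoidalCategory HomologicalComplex

universe u

namespace Literature.Algebra.Homology.TensorQuasiIsoField

variable {k : Type u} [Field k] {C C' D D' : CochainComplex (ModuleCat.{u} k) ℤ} (φ : C ⟶ C') (ψ : D ⟶ D')

/-- **Over a field `φ ⊗ ψ` is a quasi-isomorphism whenever `φ` and `ψ` are** (unbounded complexes, both factors).
[cite: Weibel1994, Thm. 3.6.3] [cite: CartanEilenberg1956, VI.3 Thm. 3.1] -/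
theorem quasiIso_tensorHom_of_field [QuasiIso φ] [QuasiIso ψ] : QuasiIso (HomologicalComplex.tensorHom φ ψ) := by
  obtain ⟨e₁, h₁⟩ := QuasiIsoHomotopyEquivField.exists_homotopyEquiv_hom_eq_of_quasiIso φ
  obtain ⟨e₂, h₂⟩ := QuasiIsoHomotopyEquivField.exists_homotopyEquiv_hom_eq_of_quasiIso ψ
  subst h₁ h₂
  exact (tensorHomotopyEquiv e₁ e₂).quasiIso_hom

/-- Over a field `C ◁ ψ` is a quasi-isomorphism when `ψ` is (any complex `C`). [cite: Weibel1994, Thm. 3.6.3] -/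
theorem quasiIso_whiskerLeft_of_field (C : CochainComplex (ModuleCat.{u} k) ℤ) [QuasiIso ψ] : QuasiIso (C ◁ ψ) := by
  rw [← MonoidalCategory.id_tensorHom]
  exact quasiIso_tensorHom_of_field (𝟙 C) ψ

/-- Over a field `φ ▷ D` is a quasi-isomorphism when `φ` is (any complex `D`). [cite: Weibel1994, Thm. 3.6.3] -/
theorem quasiIso_whiskerRight_of_field (D : CochainComplex (ModuleCat.{u} k) ℤ) [QuasiIso φ] : QuasiIso (φ ▷ D) := by
  rw [← MonoidalCategory.tensorHom_id]
  exact quasiIso_tensorHom_of_field φ (𝟙 D)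

/-- The induced map `Hⁿ(C ⊗ D) ⟶ Hⁿ(C' ⊗ D')` is an isomorphism. [cite: Weibel1994, Thm. 3.6.3] -/
theorem isIso_homologyMap_tensorHom_of_field [QuasiIso φ] [QuasiIso ψ] (n : ℤ) :
    IsIso (homologyMap (HomologicalComplex.tensorHom φ ψ) n) := by
  haveI := quasiIso_tensorHom_of_field φ ψ
  infer_instance

/-- **Over a field, tensoring with any complex preserves acyclicity on both sides**: if `φ` and `ψ` are quasi-isomorphisms
then `C ⊗ D` and `C' ⊗ D'` are homotopy equivalent. [cite: Weibel1994, Thm. 3.6.3] -/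
theorem nonempty_homotopyEquiv_tensorObj_of_quasiIso [QuasiIso φ] [QuasiIso ψ] :
    Nonempty (HomotopyEquiv (HomologicalComplex.tensorObj C D) (HomologicalComplex.tensorObj C' D')) :=
  haveI := quasiIso_tensorHom_of_field φ ψ
  QuasiIsoHomotopyEquivField.nonempty_homotopyEquiv_of_quasiIso (HomologicalComplex.tensorHom φ ψ)

end Literature.Algebra.Homology.TensorQuasiIsoField
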